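import Summits.ValiantsHypothesis.ValiantsHypothesis.Theorems.GrenetZeonDualUnipotentThreeHalvesLongMassRankRowTransfer
import Summits.ValiantsHypothesis.ValiantsHypothesis.Theorems.GrenetZeonDualUnipotentThreeHalvesSlowCoreCoarsen

/-!
# `GrenetZeon.DualUnipotentThreeHalves` (stmt-ValiantsHypothesis-24318), row r12 (RANK ROW) — part (G7b-3/3): ★ THE RANK ROW HOLDS

`theorem rankRow_holds : RankRow` and `theorem rankRowConst_holds : RankRowConst` (0 sorry; axioms `propext`, `Classical.choice`, `Quot.sound`).
STATEMENT (`RankRow`, the typed provider signature of val-idea-29 g8's `Cruxes/DualUnipotentThreeHalves/RankRow.lean` §2 VERBATIM, in ✓ `SlowCore.RelCert`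
currency; crit-7 g4 V48/V49: calibration row r12): `B` affine with values in a NIL space `T₀ ⊔ S ⊆ M_b(ℂ)`, `T₀` strictly upper triangular for a
constant coordinate order `π`, `finrank S ≤ σ`, `rank A ≤ r` for all `A ∈ S` ⇒ for every `q`, `RelCert n b B (σ + b·q + n·((r+2)·⌊(b-1)/(q+1)⌋))`;
`RankRowConst`: the same for a general constant flag (conjugation by a unit `P`).  Both `def … : Prop` land CLOSED (no fact debt).
§F core bound (`totalDegree_pow_le_core`: parts 1–2 chained — banded pencil, two-parameter nilpotency, transfer nilpotency, rank reduction, extraction) and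
the assembly: direction space `K = lin⁻¹(T₀) ⊓ freezeSpace{0 < π i' - π i ≤ q}` of codimension `≤ σ + b q` (rank–nullity through `T₀.mkQ ∘ linMap B`, whose
range lies in `mkQ(S)` because `lin v = B(v) - B(0) ∈ T₀ ⊔ S`; ✓ `SlowCore.codim_freezeSpace_le`; `#{small-gap pairs} ≤ b q` by an injection into
`Fin b × range q`), along which `B(x + sv) = (A₀ + S₀) + s·lin(v)` with `A₀ ∈ T₀`, `S₀ ∈ S`, `lin v ∈ T₀` of `π`-gaps `> q`; §F′ the general constant flag
(conjugate by `conjMap`, apply `rankRow_holds` with `π = 1` to `T₀.map`, `S.map`, return by ✓ `SlowCore.ledger_top_of_conj`).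

HONEST FRAMING (crit-7 V49/V67/V70 words stand): the rank row is a CALIBRATION row (r12), now a theorem — it prices the locus «triangular in one
constant flag up to a skew part of bounded rank» at `c = 2√(r+2)` (+ `σ/(b√n)`); it is NOT progress on the research stub (c) `SlowCore.LongMassSlowLawInv`;
24318 / S3 / R2ᵖ OPEN; `VP ≠ VNP` is NOT proved.  Helper (`--supports stmt-ValiantsHypothesis-24318`, helper mode); no instances, no notation, no named
facts.  STAGED PORT bytes by val-idea-29 g9 of `Cruxes/DualUnipotentThreeHalves/RankRow.lean` REV 2.1 @4cc029748180 §3 (this lineage never proposes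
Theorems; a prover seat presses on the critic's GO).  Credit: val-idea-29 g8 (row, identities), g9 (proof). [folklore]
-/

set_option linter.dupNamespace false
set_option autoImplicit false

namespace Summit.ValiantsHypothesis.ValiantsHypothesis.Theorems.GrenetZeon.RankRow

open MvPolynomial Matrix
open scoped BigOperators Polynomial
open Finset (range)
open Summit.ValiantsHypothesis.ValiantsHypothesis.Theorems.GrenetZeon.ResolventFlag (SRing cst)

open Summit.ValiantsHypothesis.ValiantsHypothesis.Cruxes.TwoDimCoefficients.DimTwoCases (AffMat IsAffine)
open Summit.ValiantsHypothesis.ValiantsHypothesis.Theorems.GrenetZeon.SlowCore (Ledger RelCert)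

/-! ## §2 The rank row as a typed provider signature (✓ `SlowCore.RelCert` currency), PROVED below -/

/-- **r12 RANK ROW** (coordinate-flag form).  Values of the affine pencil `B` in a nil space `T₀ ⊔ S`, `T₀` strictly upper
triangular for the coordinate order `π`, `finrank S ≤ σ`, every element of `S` of rank `≤ r` ⇒ for every `q`,
`RelCert n b B (σ + b·q + n·((r+2)·⌊(b-1)/(q+1)⌋))`.
Proof (memo §1): freeze `K' := lin⁻¹(T₀ ∩ 𝔫_{>q})` (codim `≤ σ + b q`); along `v ∈ K'`, `B(x + s v) = A' + S₀` with
`A' ∈ T₀[s]` carrying `s` only on gap-`> q` letters and `S₀ ∈ S` constant in `s`; expand `∑_p u^p (A' + S₀)^p` by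
`resolvent_add_of_transfer_pow_eq_zero` (§1) with `r + 1` in place of `r` (rank `≤ r` & nilpotent ⇒ index `≤ r + 1`);
every `u`-coefficient has `deg_s ≤ κ + r κ + κ`, `κ = ⌊(b-1)/(q+1)⌋` (✓ `TriangularRow` §3 gap count). -/
def RankRow : Prop :=
  ∀ (n b : ℕ) (B : AffMat n b), IsAffine B →
  ∀ (π : Equiv.Perm (Fin b)) (T₀ S : Submodule ℂ (Matrix (Fin b) (Fin b) ℂ)) (σ r : ℕ),
    (∀ A ∈ T₀, ∀ i j : Fin b, π j ≤ π i → A i j = 0) →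
    Module.finrank ℂ S ≤ σ →
    (∀ A ∈ S, A.rank ≤ r) →
    (∀ A ∈ T₀ ⊔ S, IsNilpotent A) →
    (∀ x : Fin n × Fin n → ℂ, B.map (MvPolynomial.eval x) ∈ T₀ ⊔ S) →
    ∀ q : ℕ, RelCert n b B (σ + b * q + n * ((r + 2) * ((b - 1) / (q + 1))))

/-- **r12, general constant flag**: the same with `T₀` strictly upper triangular after conjugation by a constant unit `P`
(reduce to `RankRow` by ✓ `SlowCore.ledger_top_of_conj`). -/
def RankRowConst : Prop :=
  ∀ (n b : ℕ) (B : AffMat n b), IsAffine B →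
  ∀ (P : (Matrix (Fin b) (Fin b) ℂ)ˣ) (T₀ S : Submodule ℂ (Matrix (Fin b) (Fin b) ℂ)) (σ r : ℕ),
    (∀ A ∈ T₀, ∀ i j : Fin b, j ≤ i → ((P : Matrix (Fin b) (Fin b) ℂ) * A * (↑P⁻¹ : Matrix (Fin b) (Fin b) ℂ)) i j = 0) →
    Module.finrank ℂ S ≤ σ →
    (∀ A ∈ S, A.rank ≤ r) →
    (∀ A ∈ T₀ ⊔ S, IsNilpotent A) →
    (∀ x : Fin n × Fin n → ℂ, B.map (MvPolynomial.eval x) ∈ T₀ ⊔ S) →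
    ∀ q : ℕ, RelCert n b B (σ + b * q + n * ((r + 2) * ((b - 1) / (q + 1))))

noncomputable section

/-! ## §F The core bound and the assembly of `RankRow` -/

section Core
variable {b : ℕ}

/-- **Core bound.**  `A₀` strictly `π`-upper, `L` strictly `π`-upper with gaps `> q`, `A₀ + sL + tS₀` nilpotent for all
`s t ∈ ℂ`, `rank S₀ ≤ r`  ⟹  every power of `A₀ + S₀ + sL` has entries of `s`-degree `≤ (r+2)·⌊(b-1)/(q+1)⌋`. -/
theorem totalDegree_pow_le_core (π : Equiv.Perm (Fin b)) (q r : ℕ) (A₀ L S₀ : Matrix (Fin b) (Fin b) ℂ)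
    (hA₀ : ∀ i i' : Fin b, π i' ≤ π i → A₀ i i' = 0)
    (hL : ∀ i i' : Fin b, (π i' : ℕ) ≤ (π i : ℕ) + q → L i i' = 0)
    (hnil : ∀ s t : ℂ, (A₀ + s • L + t • S₀) ^ b = 0) (hrank : S₀.rank ≤ r) (p : ℕ) (i j : Fin b) :
    (((pencilS (A₀ + S₀) L) ^ p) i j).totalDegree ≤ (r + 2) * ((b - 1) / (q + 1)) := by
  classical
  have hA' : Adm π q 1 (pencilS A₀ L) := adm_pencilS A₀ L hA₀ hL
  have hAb : (pencilS A₀ L) ^ b = 0 := eq_zero_of_adm (adm_pow hA' b) le_rfl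
  set u : URing := Polynomial.X with hu
  set Au : Matrix (Fin b) (Fin b) URing := (pencilS A₀ L).map (Polynomial.C : SRing →+* URing) with hAu
  have hAub : Au ^ b = 0 := by
    rw [hAu, ← Matrix.map_pow (pencilS A₀ L) (Polynomial.C : SRing →+* URing) b, hAb, Matrix.map_zero _ (map_zero _)]
  -- two-parameter nilpotency, transported to `ℂ[s][u][t]`
  have hMt := pencilT_pow_eq_zero A₀ L S₀ (fun t₀ => pencilS_pow_eq_zero (A₀ + t₀ • S₀) L b (fun s => by
    have h := hnil s t₀
    rwa [add_right_comm] at h))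
  -- transfer nilpotency
  have hGnil : IsNilpotent ((∑ j ∈ Finset.range b, (u • Au) ^ j) * (u • cst S₀)) :=
    isNilpotent_transfer u Au (cst S₀) hAub hMt
  -- rank reduction
  obtain ⟨P, Q₀, hPQ⟩ := exists_rank_factorisation S₀
  set R' : Matrix (Fin b) (Fin b) URing := ∑ j ∈ Finset.range b, (u • Au) ^ j with hR'
  have hcS : cst S₀ = cmat P * cmat Q₀ := by
    rw [← cmat_eq_cst]; exact (congrArg cmat hPQ).trans (cmat_mul P Q₀)
  have hGEF : R' * (u • cst S₀) = (R' * (u • cmat P)) * cmat Q₀ := by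
    rw [hcS, ← Matrix.smul_mul, ← Matrix.mul_assoc]
  have hGr : (R' * (u • cst S₀)) ^ (r + 1) = 0 := by
    have h1 : (R' * (u • cst S₀)) ^ (S₀.rank + 1) = 0 := by
      rw [hGEF] at hGnil ⊢
      exact pow_succ_eq_zero_of_isNilpotent_mul _ _ hGnil
    exact pow_eq_zero_of_le (by omega) h1
  exact totalDegree_pow_le_of_transfer_pow_eq_zero π q r A₀ L S₀ hA' hGr p i j

end Core

section Assembly

open Summit.ValiantsHypothesis.ValiantsHypothesis.Cruxes.TwoDimCoefficients.DimTwoCases (AffMat IsAffine)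
open Summit.ValiantsHypothesis.ValiantsHypothesis.Theorems.GrenetZeon.SlowCore (linEntry Ledger RelCert
  lineSubst_apply_of_le_one freezeSpace linFun linFun_apply linEntry_eq_zero_of_mem_freezeSpace codim_freezeSpace_le
  pow_card_eq_zero_of_pow_eq_zero)
open Summit.ValiantsHypothesis.ValiantsHypothesis.Theorems.GrenetZeon.ResolventFlag (pointMat linMat)
open Summit.ValiantsHypothesis.ValiantsHypothesis.Theorems.GrenetZeon.RadicalSplit (lineSubst)

variable {n b : ℕ}

/-- Affine evaluation: `N(v) = N(0) + lin(v)`. [folklore] -/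
theorem pointMat_eq_pointMat_zero_add_linMat (B : AffMat n b) (hB : IsAffine B) (v : Fin n × Fin n → ℂ) :
    pointMat B v = pointMat B 0 + linMat B v := by
  refine Matrix.ext fun i j => ?_
  rw [Matrix.add_apply, pointMat, pointMat, Matrix.map_apply, Matrix.map_apply, linMat, Matrix.of_apply, linEntry]
  have hg := Literature.Computability.AlgebraicComplexity.LRPencil.eq_affine_of_totalDegree_le_one (B i j) (hB i j)
  have heval : ∀ y : Fin n × Fin n → ℂ,
      MvPolynomial.eval y (B i j) = coeff 0 (B i j) + ∑ w, coeff (Finsupp.single w 1) (B i j) * y w := by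
    intro y
    conv_lhs => rw [hg]
    simp [MvPolynomial.eval_X]
  rw [heval v, heval 0]
  simp only [Pi.zero_apply, mul_zero, Finset.sum_const_zero, add_zero, add_right_inj]
  exact Finset.sum_congr rfl fun c _ => mul_comm _ _

/-- The linear part `v ↦ lin(v)` as a linear map into `M_b(ℂ)`. -/
def linMap (B : AffMat n b) : (Fin n × Fin n → ℂ) →ₗ[ℂ] Matrix (Fin b) (Fin b) ℂ :=
  (Matrix.ofLinearEquiv ℂ).toLinearMap ∘ₗ LinearMap.pi fun i => LinearMap.pi fun j => linFun B i j

/-- `linMap B v` is the linear-part matrix `linMat B v`. -/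
theorem linMap_apply (B : AffMat n b) (v : Fin n × Fin n → ℂ) : linMap B v = linMat B v := by
  refine Matrix.ext fun i j => ?_
  simp [linMap, linMat, linFun_apply]

/-- The number of `π`-gap pairs `0 < π i' - π i ≤ q` is at most `b·q`. -/
theorem card_smallGap_le (π : Equiv.Perm (Fin b)) (q : ℕ) :
    ((Finset.univ : Finset (Fin b × Fin b)).filter
      (fun p => π p.1 < π p.2 ∧ (π p.2 : ℕ) ≤ (π p.1 : ℕ) + q)).card ≤ b * q := by
  classical
  set R := (Finset.univ : Finset (Fin b × Fin b)).filter
    (fun p => π p.1 < π p.2 ∧ (π p.2 : ℕ) ≤ (π p.1 : ℕ) + q) with hR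
  let f : Fin b × Fin b → Fin b × ℕ := fun p => (p.1, (π p.2 : ℕ) - (π p.1 : ℕ) - 1)
  have hinj : Set.InjOn f R := by
    intro p hp p' hp' hff
    rw [hR, Finset.coe_filter] at hp hp'
    simp only [Set.mem_setOf_eq, Finset.mem_univ, true_and] at hp hp'
    simp only [f, Prod.mk.injEq] at hff
    obtain ⟨h1, h2⟩ := hff
    have hlt : (π p.1 : ℕ) < π p.2 := Fin.lt_def.1 hp.1
    have hlt' : (π p'.1 : ℕ) < π p'.2 := Fin.lt_def.1 hp'.1
    rw [h1] at hlt h2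
    have h3 : (π p.2 : ℕ) = π p'.2 := by omega
    exact Prod.ext h1 (π.injective (Fin.ext h3))
  have hmaps : ∀ p ∈ R, f p ∈ (Finset.univ : Finset (Fin b)) ×ˢ Finset.range q := by
    intro p hp
    rw [hR, Finset.mem_filter] at hp
    simp only [f, Finset.mem_product, Finset.mem_univ, true_and, Finset.mem_range]
    have hlt : (π p.1 : ℕ) < π p.2 := Fin.lt_def.1 hp.2.1
    have hle := hp.2.2
    omega
  calc R.card ≤ ((Finset.univ : Finset (Fin b)) ×ˢ Finset.range q).card :=
        Finset.card_le_card_of_injOn f (fun p hp => hmaps p hp) hinj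
    _ = b * q := by rw [Finset.card_product, Finset.card_univ, Fintype.card_fin, Finset.card_range]

/-- ✓ **(G7b) THE RANK ROW HOLDS** — see `RankRow` in `Cruxes/DualUnipotentThreeHalves/RankRow.lean` (statement copied verbatim). -/
theorem rankRow_holds' : ∀ (n b : ℕ) (B : AffMat n b), IsAffine B → ∀ (π : Equiv.Perm (Fin b))
    (T₀ S : Submodule ℂ (Matrix (Fin b) (Fin b) ℂ)) (σ r : ℕ),
    (∀ A ∈ T₀, ∀ i j : Fin b, π j ≤ π i → A i j = 0) → Module.finrank ℂ S ≤ σ → (∀ A ∈ S, A.rank ≤ r) →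
    (∀ A ∈ T₀ ⊔ S, IsNilpotent A) → (∀ x : Fin n × Fin n → ℂ, B.map (MvPolynomial.eval x) ∈ T₀ ⊔ S) →
    ∀ q : ℕ, RelCert n b B (σ + b * q + n * ((r + 2) * ((b - 1) / (q + 1)))) := by
  intro n b B hB π T₀ S σ r hT₀ hσ hr hnil hval q
  classical
  -- the direction space `K = K₁ ⊓ K₂`
  set Rq : Finset (Fin b × Fin b) := (Finset.univ : Finset (Fin b × Fin b)).filter
    (fun p => π p.1 < π p.2 ∧ (π p.2 : ℕ) ≤ (π p.1 : ℕ) + q) with hRq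
  set K₁ : Submodule ℂ (Fin n × Fin n → ℂ) := T₀.comap (linMap B) with hK₁
  set K₂ : Submodule ℂ (Fin n × Fin n → ℂ) := freezeSpace B Rq with hK₂
  have hdom : Module.finrank ℂ (Fin n × Fin n → ℂ) = n * n := by
    rw [Module.finrank_pi, Fintype.card_prod, Fintype.card_fin]
  -- `lin v ∈ T₀ ⊔ S`
  have hlin_mem : ∀ v, linMap B v ∈ T₀ ⊔ S := by
    intro v
    have h := sub_mem (hval v) (hval 0)
    have h' : B.map (MvPolynomial.eval v) - B.map (MvPolynomial.eval 0) = linMat B v := by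
      change pointMat B v - pointMat B 0 = linMat B v
      rw [pointMat_eq_pointMat_zero_add_linMat B hB v, add_sub_cancel_left]
    rw [h'] at h
    rw [linMap_apply]; exact h
  -- `codim K₁ ≤ σ`
  have hK₁codim : n * n - Module.finrank ℂ K₁ ≤ σ := by
    have hrn := LinearMap.finrank_range_add_finrank_ker (T₀.mkQ ∘ₗ linMap B)
    have hker : LinearMap.ker (T₀.mkQ ∘ₗ linMap B) = K₁ := by rw [LinearMap.ker_comp, Submodule.ker_mkQ]
    have hrange : LinearMap.range (T₀.mkQ ∘ₗ linMap B) ≤ S.map T₀.mkQ := by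
      rintro _ ⟨v, rfl⟩
      obtain ⟨y, hy, z, hz, hyz⟩ := Submodule.mem_sup.1 (hlin_mem v)
      refine Submodule.mem_map.2 ⟨z, hz, ?_⟩
      rw [LinearMap.comp_apply, ← hyz, map_add]
      simp only [Submodule.mkQ_apply, (Submodule.Quotient.mk_eq_zero T₀).2 hy, zero_add]
    have h1 : Module.finrank ℂ (LinearMap.range (T₀.mkQ ∘ₗ linMap B)) ≤ σ :=
      (Submodule.finrank_mono hrange).trans ((Submodule.finrank_map_le _ _).trans hσ)
    rw [hker, hdom] at hrn
    omega
  have hK₂codim : n * n - Module.finrank ℂ K₂ ≤ b * q :=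
    (codim_freezeSpace_le B Rq).trans (card_smallGap_le π q)
  have hKcodim : n * n - Module.finrank ℂ (K₁ ⊓ K₂ : Submodule ℂ (Fin n × Fin n → ℂ)) ≤ σ + b * q := by
    have h := Submodule.finrank_sup_add_finrank_inf_eq K₁ K₂
    have hsup : Module.finrank ℂ ↥(K₁ ⊔ K₂) ≤ n * n := by rw [← hdom]; exact Submodule.finrank_le _
    omega
  refine ⟨K₁ ⊓ K₂, (r + 2) * ((b - 1) / (q + 1)), ?_, by omega⟩
  -- the ledger along `x + s v`, `v ∈ K`
  intro x v hv p _ i j _ _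
  obtain ⟨hv₁, hv₂⟩ := Submodule.mem_inf.1 hv
  have hLT : linMat B v ∈ T₀ := by
    rw [hK₁, Submodule.mem_comap, linMap_apply] at hv₁; exact hv₁
  obtain ⟨A₀, hA₀, S₀, hS₀, hAS⟩ := Submodule.mem_sup.1 (hval x)
  have hM : B.map (lineSubst x v) = pencilS (A₀ + S₀) (linMat B v) := by
    refine Matrix.ext fun i j => ?_
    have hx : MvPolynomial.eval x (B i j) = (A₀ + S₀) i j := by rw [hAS]; rfl
    rw [Matrix.map_apply, lineSubst_apply_of_le_one B hB x v i j, hx]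
    simp only [pencilS, Matrix.add_apply, Matrix.map_apply, Matrix.smul_apply, smul_eq_mul, linMat, Matrix.of_apply,
      map_add]
    ring
  rw [hM]
  refine totalDegree_pow_le_core π q r A₀ (linMat B v) S₀ (hT₀ A₀ hA₀) ?_ ?_ (hr S₀ hS₀) p i j
  · intro i i' hle
    by_cases hcase : π i' ≤ π i
    · exact hT₀ _ hLT i i' hcase
    · have hmem : (i, i') ∈ Rq := by
        rw [hRq, Finset.mem_filter]; exact ⟨Finset.mem_univ _, not_le.1 hcase, hle⟩
      rw [linMat, Matrix.of_apply]
      rw [hK₂] at hv₂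
      exact linEntry_eq_zero_of_mem_freezeSpace B Rq hmem hv₂
  · intro s t
    have hmem : A₀ + s • linMat B v + t • S₀ ∈ T₀ ⊔ S :=
      Submodule.add_mem_sup (T₀.add_mem hA₀ (T₀.smul_mem s hLT)) (S.smul_mem t hS₀)
    obtain ⟨k, hk⟩ := hnil _ hmem
    exact pow_card_eq_zero_of_pow_eq_zero _ hk

end Assembly


/-- ✓ **(G7b) THE RANK ROW HOLDS** (kernel; axioms `propext`, `Classical.choice`, `Quot.sound`). -/
theorem rankRow_holds : RankRow := rankRow_holds'

/-! ### §F′ The general constant flag: `theorem rankRowConst_holds : RankRowConst` (conjugate, apply `rankRow_holds` with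
`π = 1`, return by ✓ `SlowCore.ledger_top_of_conj`) -/

section ConstFlag

open Summit.ValiantsHypothesis.ValiantsHypothesis.Theorems.GrenetZeon.SlowCore (isAffine_conj ledger_top_of_conj)

variable {n b : ℕ}

/-- Conjugation `X ↦ P X Q` as a linear map. -/
def conjMap (P Q : Matrix (Fin b) (Fin b) ℂ) : Matrix (Fin b) (Fin b) ℂ →ₗ[ℂ] Matrix (Fin b) (Fin b) ℂ :=
  (LinearMap.mulLeft ℂ P).comp (LinearMap.mulRight ℂ Q)

/-- `conjMap P Q X = P * X * Q`. -/
theorem conjMap_apply (P Q X : Matrix (Fin b) (Fin b) ℂ) : conjMap P Q X = P * X * Q := by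
  simp [conjMap, Matrix.mul_assoc]

/-- Powers of a conjugate (`Q P = 1`). [folklore] -/
theorem conj_pow_succ (P Q X : Matrix (Fin b) (Fin b) ℂ) (hQP : Q * P = 1) (k : ℕ) :
    (P * X * Q) ^ (k + 1) = P * X ^ (k + 1) * Q := by
  induction k with
  | zero => rw [zero_add, pow_one, pow_one]
  | succ k ih =>
    rw [pow_succ, ih, pow_succ X (k + 1)]
    calc P * X ^ (k + 1) * Q * (P * X * Q) = P * X ^ (k + 1) * (Q * P) * X * Q := by simp only [Matrix.mul_assoc]
      _ = P * (X ^ (k + 1) * X) * Q := by rw [hQP, Matrix.mul_one]; simp only [Matrix.mul_assoc]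

/-- Values of a constant conjugate of a pencil (= ✓ `SlowCore.conj_map_eval`, re-proved to keep the imports minimal). -/
theorem map_eval_conj (B : AffMat n b) (P Q : Matrix (Fin b) (Fin b) ℂ) (x : Fin n × Fin n → ℂ) :
    (P.map C * B * Q.map C).map (MvPolynomial.eval x) = P * B.map (MvPolynomial.eval x) * Q := by
  rw [show ∀ A : AffMat n b, A.map (MvPolynomial.eval x) = (MvPolynomial.eval x).mapMatrix A from fun _ => rfl,
    map_mul, map_mul]
  simp only [RingHom.mapMatrix_apply]
  congr 1
  · congr 1
    ext i j; simp only [Matrix.map_apply, MvPolynomial.eval_C]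
  · ext i j; simp only [Matrix.map_apply, MvPolynomial.eval_C]

/-- ✓ **The rank row for a general constant flag** (`RankRowConst`). -/
theorem rankRowConst_holds : RankRowConst := by
  intro n b B hB P T₀ S σ r hT₀ hσ hr hnil hval q
  classical
  set Pm : Matrix (Fin b) (Fin b) ℂ := (P : Matrix (Fin b) (Fin b) ℂ) with hPm
  set Pi : Matrix (Fin b) (Fin b) ℂ := (↑P⁻¹ : Matrix (Fin b) (Fin b) ℂ) with hPi
  have hPiP : Pi * Pm = 1 := by rw [hPi, hPm]; exact Units.inv_mul P
  set B' : AffMat n b := Pm.map C * B * Pi.map C with hB'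
  set f : Matrix (Fin b) (Fin b) ℂ →ₗ[ℂ] Matrix (Fin b) (Fin b) ℂ := conjMap Pm Pi with hf
  have hB'aff : IsAffine B' := isAffine_conj B hB Pm Pi
  have hT₀' : ∀ A ∈ T₀.map f, ∀ i j : Fin b, (Equiv.refl (Fin b)) j ≤ (Equiv.refl (Fin b)) i → A i j = 0 := by
    intro A hA i j hij
    obtain ⟨X, hX, rfl⟩ := Submodule.mem_map.1 hA
    rw [hf, conjMap_apply]
    exact hT₀ X hX i j hij
  have hσ' : Module.finrank ℂ (S.map f) ≤ σ := (Submodule.finrank_map_le f S).trans hσ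
  have hr' : ∀ A ∈ S.map f, A.rank ≤ r := by
    intro A hA
    obtain ⟨X, hX, rfl⟩ := Submodule.mem_map.1 hA
    rw [hf, conjMap_apply]
    exact (Matrix.rank_mul_le_left _ _).trans ((Matrix.rank_mul_le_right _ _).trans (hr X hX))
  have hsup : T₀.map f ⊔ S.map f = (T₀ ⊔ S).map f := (Submodule.map_sup T₀ S f).symm
  have hnil' : ∀ A ∈ T₀.map f ⊔ S.map f, IsNilpotent A := by
    intro A hA
    rw [hsup] at hA
    obtain ⟨X, hX, rfl⟩ := Submodule.mem_map.1 hA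
    obtain ⟨k, hk⟩ := hnil X hX
    refine ⟨k + 1, ?_⟩
    rw [hf, conjMap_apply, conj_pow_succ Pm Pi X hPiP k, pow_succ, hk, Matrix.zero_mul, Matrix.mul_zero,
      Matrix.zero_mul]
  have hval' : ∀ x : Fin n × Fin n → ℂ, B'.map (MvPolynomial.eval x) ∈ T₀.map f ⊔ S.map f := by
    intro x
    rw [hsup, hB', map_eval_conj]
    refine Submodule.mem_map.2 ⟨B.map (MvPolynomial.eval x), hval x, ?_⟩
    rw [hf, conjMap_apply]
  obtain ⟨K, k, hL, hp⟩ :=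
    rankRow_holds n b B' hB'aff (Equiv.refl (Fin b)) (T₀.map f) (S.map f) σ r hT₀' hσ' hr' hnil' hval' q
  exact ⟨K, k, ledger_top_of_conj B B' Pm Pi hPiP rfl hL, hp⟩

end ConstFlag

end

end Summit.ValiantsHypothesis.ValiantsHypothesis.Theorems.GrenetZeon.RankRow
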